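import Mathlib
import Summits.Ventures.PercRepro2.KPrimeRootLeaf

/-!
# The root `a₁` on a leaf: the Bernstein split in the vocabulary of the `z`-instance
(blind cell PercRepro2, mine-c g42; `conjectures/MINE-C.md` §51.4)

The mirror of `KPrimeRootLeaf.lean` for the root `a₁`: let `a₁` be a LEAF whose only edge is
`e = {a₁, z}` (weight `t = p e`).  With `e` pinned CLOSED `a₁` is isolated: `U = X = W = ∅`,
`Ω = N =` everything, `S = {a₂ ↮ v}`, and the ten masses are `isoMassesA₁ =
(0, 0, 1, 0, P(Y ∩ {a₂ ↮ v}), P(a₂ ↮ v), 0, 0, 0, 0)`, whose form `F₀` vanishes.  With `e` pinned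
OPEN `a₁` is connected exactly to what `z` is, and the masses are those of the `z`-instance
(`z` in the role of `a₁`).  Hence

  `kprimeForm(a₁-instance, p) = t (1 − t)² G₁ + t² (1 − t) G₂ + t³ F₁`

(`kprimeForm_rootLeaf_a₁`; `F₁ = kprimeForm(z-instance)`, `G₁ = mixedOne M⁰ M¹`, `G₂ = mixedTwo M⁰ M¹`),
and `(K′)` with `a₁` on the leaf follows from `(K′)` at the `z`-instance and `G₁, G₂ ≥ 0`
(`kprime_of_rootLeaf_a₁`).
-/

namespace Summit.Ventures.PercRepro2

namespace KPrime

variable {V : Type*} {E : Type*} [Fintype E] [DecidableEq E] [Fintype V] [DecidableEq V]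
  {R : Type*} [Field R] [LinearOrder R] [IsStrictOrderedRing R]

section Iso

variable (ends : E → Sym2 V) (a₂ v y : V) (p : E → R)

/-- The mass vector of an instance whose root `a₁` is isolated:
`0, 0, 1, 0, P(Y ∩ {a₂ ↮ v}), P(a₂ ↮ v), 0, 0, 0, 0`. -/
noncomputable def isoMassesA₁ : Fin 10 → R
  | 0 => 0
  | 1 => 0
  | 2 => 1
  | 3 => 0
  | 4 => prob p (connEvent ends a₂ y ∩ avoidAll ends a₂ {v})
  | 5 => prob p (avoidAll ends a₂ {v})
  | 6 => 0
  | 7 => 0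
  | 8 => 0
  | 9 => 0

omit [Fintype V] [DecidableEq V] [LinearOrder R] [IsStrictOrderedRing R] in
/-- The isolated form of an isolated `a₁` vanishes. -/
lemma kformTri_isoMassesA₁ :
    kformTri (isoMassesA₁ ends a₂ v y p) (isoMassesA₁ ends a₂ v y p) (isoMassesA₁ ends a₂ v y p) =
      0 := by
  simp only [kformTri, isoMassesA₁]
  ring

end Iso

section Leaf

variable {ends : E → Sym2 V} {a₁ a₂ b v y z : V} {p : E → R} {e : E}

omit [Fintype V] [IsStrictOrderedRing R] in
/-- The masses of the `a₁`-instance with the leaf edge pinned open are those of the `z`-instance. -/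
theorem kmasses_update_one_rootLeafA₁ (hleaf : ∀ f, a₁ ∈ ends f → f = e)
    (hends : ends e = s(a₁, z)) (h2 : a₂ ≠ a₁) (hb : b ≠ a₁) (hv : v ≠ a₁) (hy : y ≠ a₁)
    (hz : z ≠ a₁) (he : p e ≠ 1) :
    kmasses ends a₁ a₂ b v y (Function.update p e 1) =
      kmasses ends z a₂ b v y (Function.update p e 0) := by
  have fU : FlipInvAt p e (connEvent ends z v) := flipInvAt_connEvent hleaf hends hz hv
  have fX : FlipInvAt p e (connEvent ends z b) := flipInvAt_connEvent hleaf hends hz hb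
  have fW : FlipInvAt p e (connEvent ends z y) := flipInvAt_connEvent hleaf hends hz hy
  have fY : FlipInvAt p e (connEvent ends a₂ y) := flipInvAt_connEvent hleaf hends h2 hy
  have fCv : FlipInvAt p e (connEvent ends v b) := flipInvAt_connEvent hleaf hends hv hb
  have fΩ : FlipInvAt p e (Ω ends z a₂) :=
    flipInvAt_avoidAll hleaf hends hz (by simpa using h2)
  have fS : FlipInvAt p e (S ends z a₂ v) := by
    refine flipInvAt_avoidAll hleaf hends h2 ?_
    intro x hx
    simp only [Finset.mem_insert, Finset.mem_singleton] at hx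
    rcases hx with rfl | rfl
    · exact hz
    · exact hv
  have fN : FlipInvAt p e (N ends z a₂ v) := by
    refine flipInvAt_avoidAll hleaf hends hz ?_
    intro x hx
    simp only [Finset.mem_insert, Finset.mem_singleton] at hx
    rcases hx with rfl | rfl
    · exact h2
    · exact hv
  have key : ∀ {A A' : Set (Config E)}, A ∩ openEdge e = A' ∩ openEdge e → FlipInvAt p e A' →
      prob (Function.update p e 1) A = prob (Function.update p e 0) A' := by
    intro A A' hAA' hA'
    rw [← prob_update_one_inter_openEdge, hAA', prob_update_one_inter_openEdge,
      prob_update_one_eq_update_zero_of_flipInvAt he hA']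
  -- the dictionary on `{e open}`: `a₁ ↔ x` is `z ↔ x`
  have hc : ∀ {ω : Config E}, ω e = true → ∀ {x : V}, x ≠ a₁ →
      (Conn ends ω a₁ x ↔ Conn ends ω z x) := by
    intro ω ho x hx
    exact conn_leaf_of_open' hleaf hends ho hx
  have hc' : ∀ {ω : Config E}, ω e = true → ∀ {x : V}, x ≠ a₁ →
      (Conn ends ω x a₁ ↔ Conn ends ω x z) := by
    intro ω ho x hx
    exact conn_leaf_of_open hleaf hends ho hx
  funext k
  fin_cases k <;> simp only [kmasses] <;> refine key ?_ ?_
  · ext ω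
    simp only [Set.mem_inter_iff, mem_connEvent, mem_Ω, mem_openEdge]
    constructor
    · rintro ⟨⟨⟨hU, hX⟩, hO⟩, ho⟩
      exact ⟨⟨⟨(hc ho hv).1 hU, (hc ho hb).1 hX⟩, fun h => hO ((hc ho h2).2 h)⟩, ho⟩
    · rintro ⟨⟨⟨hU, hX⟩, hO⟩, ho⟩
      exact ⟨⟨⟨(hc ho hv).2 hU, (hc ho hb).2 hX⟩, fun h => hO ((hc ho h2).1 h)⟩, ho⟩
  · exact (fU.inter fX).inter fΩ
  · ext ω
    simp only [Set.mem_inter_iff, mem_connEvent, mem_Ω, mem_openEdge]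
    constructor
    · rintro ⟨⟨hU, hO⟩, ho⟩
      exact ⟨⟨(hc ho hv).1 hU, fun h => hO ((hc ho h2).2 h)⟩, ho⟩
    · rintro ⟨⟨hU, hO⟩, ho⟩
      exact ⟨⟨(hc ho hv).2 hU, fun h => hO ((hc ho h2).1 h)⟩, ho⟩
  · exact fU.inter fΩ
  · ext ω
    simp only [Set.mem_inter_iff, mem_N, mem_openEdge]
    constructor
    · rintro ⟨⟨hO, hU⟩, ho⟩
      exact ⟨⟨fun h => hO ((hc ho h2).2 h), fun h => hU ((hc ho hv).2 h)⟩, ho⟩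
    · rintro ⟨⟨hO, hU⟩, ho⟩
      exact ⟨⟨fun h => hO ((hc ho h2).1 h), fun h => hU ((hc ho hv).1 h)⟩, ho⟩
  · exact fN
  · ext ω
    simp only [Set.mem_inter_iff, mem_connEvent, mem_N, mem_openEdge]
    constructor
    · rintro ⟨⟨hX, hO, hU⟩, ho⟩
      exact ⟨⟨(hc ho hb).1 hX, fun h => hO ((hc ho h2).2 h), fun h => hU ((hc ho hv).2 h)⟩, ho⟩
    · rintro ⟨⟨hX, hO, hU⟩, ho⟩
      exact ⟨⟨(hc ho hb).2 hX, fun h => hO ((hc ho h2).1 h), fun h => hU ((hc ho hv).1 h)⟩, ho⟩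
  · exact fX.inter fN
  · ext ω
    simp only [Set.mem_inter_iff, mem_connEvent, mem_S, mem_openEdge]
    constructor
    · rintro ⟨⟨hY, hO, hV⟩, ho⟩
      exact ⟨⟨hY, fun h => hO ((hc' ho h2).2 h), hV⟩, ho⟩
    · rintro ⟨⟨hY, hO, hV⟩, ho⟩
      exact ⟨⟨hY, fun h => hO ((hc' ho h2).1 h), hV⟩, ho⟩
  · exact fY.inter fS
  · ext ω
    simp only [Set.mem_inter_iff, mem_S, mem_openEdge]
    constructor
    · rintro ⟨⟨hO, hV⟩, ho⟩
      exact ⟨⟨fun h => hO ((hc' ho h2).2 h), hV⟩, ho⟩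
    · rintro ⟨⟨hO, hV⟩, ho⟩
      exact ⟨⟨fun h => hO ((hc' ho h2).1 h), hV⟩, ho⟩
  · exact fS
  · ext ω
    simp only [cls01e, Set.mem_inter_iff, Set.mem_compl_iff, mem_connEvent, mem_S, mem_openEdge,
      Set.mem_union]
    constructor
    · rintro ⟨⟨⟨⟨hU, hW⟩, hO, hV⟩, hXe⟩, ho⟩
      refine ⟨⟨⟨⟨fun h => hU ((hc ho hv).2 h), (hc ho hy).1 hW⟩,
        fun h => hO ((hc' ho h2).2 h), hV⟩, ?_⟩, ho⟩
      rcases hXe with hX | hCv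
      · exact Or.inl ((hc ho hb).1 hX)
      · exact Or.inr hCv
    · rintro ⟨⟨⟨⟨hU, hW⟩, hO, hV⟩, hXe⟩, ho⟩
      refine ⟨⟨⟨⟨fun h => hU ((hc ho hv).1 h), (hc ho hy).2 hW⟩,
        fun h => hO ((hc' ho h2).1 h), hV⟩, ?_⟩, ho⟩
      rcases hXe with hX | hCv
      · exact Or.inl ((hc ho hb).2 hX)
      · exact Or.inr hCv
  · exact ((fU.compl.inter fW).inter fS).inter (fX.union fCv)
  · ext ω
    simp only [cls01, Set.mem_inter_iff, Set.mem_compl_iff, mem_connEvent, mem_S, mem_openEdge]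
    constructor
    · rintro ⟨⟨⟨hU, hW⟩, hO, hV⟩, ho⟩
      exact ⟨⟨⟨fun h => hU ((hc ho hv).2 h), (hc ho hy).1 hW⟩,
        fun h => hO ((hc' ho h2).2 h), hV⟩, ho⟩
    · rintro ⟨⟨⟨hU, hW⟩, hO, hV⟩, ho⟩
      exact ⟨⟨⟨fun h => hU ((hc ho hv).1 h), (hc ho hy).2 hW⟩,
        fun h => hO ((hc' ho h2).1 h), hV⟩, ho⟩
  · exact (fU.compl.inter fW).inter fS
  · ext ω
    simp only [Set.mem_inter_iff, mem_connEvent, mem_Ω, mem_openEdge]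
    constructor
    · rintro ⟨⟨⟨⟨hU, hY⟩, hX⟩, hO⟩, ho⟩
      exact ⟨⟨⟨⟨(hc ho hv).1 hU, hY⟩, (hc ho hb).1 hX⟩, fun h => hO ((hc ho h2).2 h)⟩, ho⟩
    · rintro ⟨⟨⟨⟨hU, hY⟩, hX⟩, hO⟩, ho⟩
      exact ⟨⟨⟨⟨(hc ho hv).2 hU, hY⟩, (hc ho hb).2 hX⟩, fun h => hO ((hc ho h2).1 h)⟩, ho⟩
  · exact ((fU.inter fY).inter fX).inter fΩ
  · ext ω
    simp only [Set.mem_inter_iff, mem_connEvent, mem_Ω, mem_openEdge]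
    constructor
    · rintro ⟨⟨⟨hU, hY⟩, hO⟩, ho⟩
      exact ⟨⟨⟨(hc ho hv).1 hU, hY⟩, fun h => hO ((hc ho h2).2 h)⟩, ho⟩
    · rintro ⟨⟨⟨hU, hY⟩, hO⟩, ho⟩
      exact ⟨⟨⟨(hc ho hv).2 hU, hY⟩, fun h => hO ((hc ho h2).1 h)⟩, ho⟩
  · exact (fU.inter fY).inter fΩ

omit [Fintype V] [LinearOrder R] [IsStrictOrderedRing R] in
/-- The masses of the `a₁`-instance with the leaf edge pinned closed are the isolated masses. -/
theorem kmasses_update_zero_rootLeafA₁ (hleaf : ∀ f, a₁ ∈ ends f → f = e) (h2 : a₂ ≠ a₁)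
    (hb : b ≠ a₁) (hv : v ≠ a₁) (hy : y ≠ a₁) :
    kmasses ends a₁ a₂ b v y (Function.update p e 0) = isoMassesA₁ ends a₂ v y (Function.update p e 0) := by
  have key : ∀ {A A' : Set (Config E)}, A ∩ closedEdge e = A' ∩ closedEdge e →
      prob (Function.update p e 0) A = prob (Function.update p e 0) A' := by
    intro A A' hAA'
    rw [← prob_update_zero_inter_closedEdge, hAA', prob_update_zero_inter_closedEdge]
  have hclosed : prob (Function.update p e 0) (closedEdge e) = 1 := by
    rw [prob_closedEdge]; simp
  have hzero : ∀ {A : Set (Config E)}, A ∩ closedEdge e = ∅ → prob (Function.update p e 0) A = 0 := by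
    intro A hA
    rw [← prob_update_zero_inter_closedEdge, hA, prob_empty]
  have nc : ∀ {ω : Config E}, ω e = false → ∀ {x : V}, x ≠ a₁ → ¬ Conn ends ω a₁ x := by
    intro ω hc x hx
    exact not_conn_leaf_of_closed' hleaf hc hx
  funext k
  fin_cases k <;> simp only [isoMassesA₁, kmasses]
  · refine hzero ?_
    rw [Set.eq_empty_iff_forall_notMem]
    rintro ω ⟨⟨⟨hU, _⟩, _⟩, hc⟩
    exact nc hc hv hU
  · refine hzero ?_
    rw [Set.eq_empty_iff_forall_notMem]
    rintro ω ⟨⟨hU, _⟩, hc⟩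
    exact nc hc hv hU
  · rw [← prob_update_zero_inter_closedEdge]
    have : N ends a₁ a₂ v ∩ closedEdge e = closedEdge e := by
      ext ω
      simp only [Set.mem_inter_iff, mem_N, mem_closedEdge, and_iff_right_iff_imp]
      intro hc
      exact ⟨nc hc h2, nc hc hv⟩
    rw [this, hclosed]
  · refine hzero ?_
    rw [Set.eq_empty_iff_forall_notMem]
    rintro ω ⟨⟨hX, _⟩, hc⟩
    exact nc hc hb hX
  · refine key ?_
    ext ω
    simp only [Set.mem_inter_iff, mem_connEvent, mem_S, mem_closedEdge, mem_avoidAll,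
      Finset.mem_singleton, forall_eq]
    constructor
    · rintro ⟨⟨hY, _, hV⟩, hc⟩; exact ⟨⟨hY, hV⟩, hc⟩
    · rintro ⟨⟨hY, hV⟩, hc⟩
      exact ⟨⟨hY, fun h => nc hc h2 (conn_symm h), hV⟩, hc⟩
  · refine key ?_
    ext ω
    simp only [Set.mem_inter_iff, mem_S, mem_closedEdge, mem_avoidAll, Finset.mem_singleton,
      forall_eq]
    constructor
    · rintro ⟨⟨_, hV⟩, hc⟩; exact ⟨hV, hc⟩
    · rintro ⟨hV, hc⟩
      exact ⟨⟨fun h => nc hc h2 (conn_symm h), hV⟩, hc⟩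
  · refine hzero ?_
    rw [Set.eq_empty_iff_forall_notMem]
    rintro ω ⟨⟨⟨⟨_, hW⟩, _⟩, _⟩, hc⟩
    exact nc hc hy hW
  · refine hzero ?_
    rw [Set.eq_empty_iff_forall_notMem]
    rintro ω ⟨⟨⟨_, hW⟩, _⟩, hc⟩
    exact nc hc hy hW
  · refine hzero ?_
    rw [Set.eq_empty_iff_forall_notMem]
    rintro ω ⟨⟨⟨⟨hU, _⟩, _⟩, _⟩, hc⟩
    exact nc hc hv hU
  · refine hzero ?_
    rw [Set.eq_empty_iff_forall_notMem]
    rintro ω ⟨⟨⟨hU, _⟩, _⟩, hc⟩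
    exact nc hc hv hU

omit [Fintype V] [IsStrictOrderedRing R] in
/-- **The root `a₁` on a leaf — the Bernstein split in the vocabulary of the `z`-instance**
(the isolated form vanishes). -/
theorem kprimeForm_rootLeaf_a₁ (hleaf : ∀ f, a₁ ∈ ends f → f = e) (hends : ends e = s(a₁, z))
    (h2 : a₂ ≠ a₁) (hb : b ≠ a₁) (hv : v ≠ a₁) (hy : y ≠ a₁) (hz : z ≠ a₁) (he : p e ≠ 1) :
    kprimeForm ends a₁ a₂ b v y p (prob p (connEvent ends a₁ b ∩ N ends a₁ a₂ v))
        (prob p (N ends a₁ a₂ v)) =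
      p e * (1 - p e) ^ 2 * mixedOne (isoMassesA₁ ends a₂ v y (Function.update p e 0))
          (kmasses ends z a₂ b v y (Function.update p e 0)) +
        (p e) ^ 2 * (1 - p e) * mixedTwo (isoMassesA₁ ends a₂ v y (Function.update p e 0))
          (kmasses ends z a₂ b v y (Function.update p e 0)) +
        (p e) ^ 3 * kprimeForm ends z a₂ b v y (Function.update p e 0)
          (prob (Function.update p e 0) (connEvent ends z b ∩ N ends z a₂ v))
          (prob (Function.update p e 0) (N ends z a₂ v)) := by
  rw [kprimeForm_bernstein_split ends a₁ a₂ b v y p e,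
    kprimeForm_eq_kformTri ends a₁ a₂ b v y (Function.update p e 0),
    kprimeForm_eq_kformTri ends a₁ a₂ b v y (Function.update p e 1),
    kmasses_update_one_rootLeafA₁ hleaf hends h2 hb hv hy hz he,
    kmasses_update_zero_rootLeafA₁ hleaf h2 hb hv hy, kformTri_isoMassesA₁,
    ← kprimeForm_eq_kformTri ends z a₂ b v y (Function.update p e 0)]
  ring

omit [Fintype V] in
/-- **`(K′)` with the root `a₁` on a leaf** from `(K′)` at the `z`-instance and the two mixed
root-leaf coefficients. -/
theorem kprime_of_rootLeaf_a₁ (hp : IsProbVec p) (hleaf : ∀ f, a₁ ∈ ends f → f = e)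
    (hends : ends e = s(a₁, z)) (h2 : a₂ ≠ a₁) (hb : b ≠ a₁) (hv : v ≠ a₁) (hy : y ≠ a₁)
    (hz : z ≠ a₁) (he : p e ≠ 1)
    (hG₁ : 0 ≤ mixedOne (isoMassesA₁ ends a₂ v y (Function.update p e 0))
      (kmasses ends z a₂ b v y (Function.update p e 0)))
    (hG₂ : 0 ≤ mixedTwo (isoMassesA₁ ends a₂ v y (Function.update p e 0))
      (kmasses ends z a₂ b v y (Function.update p e 0)))
    (hF₁ : KPrimeHolds ends z a₂ b v y (Function.update p e 0)) :
    KPrimeHolds ends a₁ a₂ b v y p := by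
  unfold KPrimeHolds at hF₁ ⊢
  rw [kprimeForm_rootLeaf_a₁ hleaf hends h2 hb hv hy hz he]
  have ht0 : 0 ≤ p e := hp.nonneg e
  have ht1 : 0 ≤ 1 - p e := sub_nonneg.2 (hp.le_one e)
  positivity

end Leaf

end KPrime

end Summit.Ventures.PercRepro2
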